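import Literature.InformationTheory.Entanglement.QuantumFisherInformationEntanglementCriterion
import HarnessLib

/-!
# The three quantum Fisher informations `F_Q[ρ, J_x] + F_Q[ρ, J_y] + F_Q[ρ, J_z]`: the separable bound `2N`
# (Tóth 2012, Observation 1), the bound `N(N+2)` for all states (Observation 2; TKGB (2a)
# `⟨J_x²⟩ + ⟨J_y²⟩ + ⟨J_z²⟩ ≤ N(N+2)/4`) and its saturation by `|GHZ_N⟩`, and Pezzè–Smerzi's `χ² ≤ ξ²` on the
# `N`-qubit register

Hodge foundations lane (`lit-hodgefound`, prover p24 gen 79; quantum-information series, file 5).  THEOREMS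
ONLY: no definition, no named fact, net debt 0.  Vocabulary: the `N`-qubit register `Fin N → Bool` of
`SpinSqueezingCriterion.lean` (`localPauli`, `collectiveSpin`, `IsSeparable`, `productVec`, `bloch`,
`variance`, `varianceT`), the states-as-functionals `vecState` / `trState` of `TsirelsonBound.lean`, and the
SLD data of the g78/g79 `StateDiscrimination` files: a Hermitian `T` with `Tρ + ρT = i(ρJ − Jρ)` is an SLD of
the unitary family `e^{−iJθ} ρ e^{iJθ}` at `θ = 0` and `F_Q[ρ, J] = 2Tr(T · i(ρJ − Jρ))`.

## Sources (read verbatim)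

* G. Tóth, *Multipartite entanglement and high-precision metrology*, Phys. Rev. A **85** (2012) 022322
  [Toth2012MultipartiteMetrology]: «Observation 1: For `N`-qubit separable states, the values of `F_Q[ϱ,J_l]`
  for `l = x, y, z` are bounded as `Σ_{l=x,y,z} F_Q[ϱ, J_l] ≤ 2N`.  Here, `J_l = ½Σ_{k=1}^N σ_l^{(k)}` …
  All states violating Eq. (F2ea) are entangled.»  «Observation 2. For quantum states, the quantum Fisher
  information is bounded by above as `Σ_{l=x,y,z} F_Q[ϱ, J_l] ≤ N(N+2)`.»  Proof of Observation 1 (§2):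
  «for every `N`-qubit pure product state … `Σ_l (ΔJ_l)² = ¼Σ_n(3 − ⟨σ_x^{(n)}⟩² − ⟨σ_y^{(n)}⟩² − ⟨σ_z^{(n)}⟩²)
  = N/2`.  For the mixture of product states … Eq. (F2ea) follows from the convexity of the Fisher
  information» (and «For a pure state `ϱ`, we have `F[ϱ,J_l] = 4(ΔJ_l)²_ϱ`»).  Proof of Observation 2:
  «`Σ_l F(ϱ,J_l) ≤ 4Σ_l (ΔJ_l)²` and … `4Σ_l (ΔJ_l)² ≤ 4Σ_l ⟨J_l²⟩ ≤ N(N+2)` … The second inequality … appears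
  as a fundamental equation in the theory of angular momentum.»
* G. Tóth, C. Knapp, O. Gühne, H. J. Briegel, PRL **99** (2007) 250405 [TothKnappGuhneBriegel2007],
  Observation 1 (2a): «`⟨J_x²⟩ + ⟨J_y²⟩ + ⟨J_z²⟩ ≤ N(N+2)/4`», Appendix: «Based on the theory of angular
  momentum, Eq. (2a) is valid for all quantum states.»
* L. Pezzè, A. Smerzi, PRL **102** (2009) 100401 [PezzeSmerzi2009], p. 2–3: «`ξ² ≡ N(ΔĴ_{n₃})²/(⟨Ĵ_{n₁}⟩² +
  ⟨Ĵ_{n₂}⟩²)`», «`χ² ≡ N/F_Q[ρ̂_inp, Ĵ_n]`», «we now demonstrate that `χ ≤ ξ` for any arbitrary `ρ̂_inp`.  We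
  consider, without loss of generality, a direction `n ≡ n₂` such that `⟨Ĵ_{n₂}⟩ = 0`.  By choosing
  `M̂ = Ĵ_{n₃} − ⟨Ĵ_{n₃}⟩` … we obtain that `F_Q[ρ̂_inp, Ĵ_n] ≥ (dM₁/dθ)²/M₂ = N/ξ²`.»
* G. Tóth, I. Apellaniz, J. Phys. A **47** (2014) 424006 [TothApellaniz2014], §5.2 eq. (xichi) («`ξ_s² ≥ χ²`»).

## What is formalized (all PROVED)

§ 1 Register Pauli algebra: `localPauli_mul_comm` (`σ_a^{(i)}σ_b^{(j)} = σ_b^{(j)}σ_a^{(i)}` for `i ≠ j`),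
`localPauli_mul_same` (`σ_a^{(i)}σ_b^{(i)} = s·σ_c^{(i)}` from `σ_aσ_b = sσ_c`), and the angular-momentum
commutation relations **`commutator_collectiveSpin`** (`[J_a, J_b] = iJ_c` whenever `σ_aσ_b = iσ_c = −σ_bσ_a`),
`commutator_X_Y`, `commutator_Y_Z`, `commutator_Z_X`.
§ 2 Pezzè–Smerzi / TA (xichi) on the register: **`sq_expect_le_qfi_mul_varianceT`** (`⟨J_c⟩² ≤ F_Q[ρ,J_a]·(ΔJ_b)²`)
and the printed quotient form **`chi_sq_le_xi_sq`** (`N/F_Q[ρ, J_{n₂}] ≤ N(ΔJ_{n₃})²/(⟨J_{n₁}⟩² + ⟨J_{n₂}⟩²)` when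
`⟨J_{n₂}⟩ = 0`, `⟨J_{n₁}⟩ ≠ 0`).
§ 3 Tóth's Observation 1: `sum_qfi_productVec_eq` (`= 2N` on pure product states, the printed first step),
`qfi_le_sum_bloch` (convexity step, per direction), **`sum_qfi_le_two_mul_of_isSeparable`** (`≤ 2N` on fully
separable states, for every triple of Hermitian SLDs), `not_isSeparable_of_sum_qfi_gt`.
§ 4 Observation 2 and TKGB (2a): the exchange identity `exchange_sq` (`T_{ij}² = 3·𝟙 − 2T_{ij}` for
`T_{ij} = Σ_l σ_l^{(i)}σ_l^{(j)}`, `i ≠ j`), `one_sub_exchange_posSemidef` (`T_{ij} ≤ 𝟙`), `sum_collectiveSpin_sq_eq`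
(`Σ_l J_l² = ¼Σ_iΣ_j T_{ij}`), the Casimir bound **`casimir_posSemidef`**
(`N(N+2)/4·𝟙 − (J_x² + J_y² + J_z²) ⪰ 0`), **`sum_expect_sq_le`** ((2a), all states), `sum_varianceT_le`,
**`sum_qfi_le`** (`Σ_l F_Q[ρ, J_l] ≤ N(N+2)`, all states and all Hermitian SLDs).

§ 5 Saturation of Observation 2 by the GHZ state («Greenberger-Horne-Zeilinger states … saturate Eq. (all)»):
`localPauli_apply_const_eq_zero`, `localPauli_mul_apply_const_eq_zero` (one / two `σ_x`- or `σ_y`-flips leave the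
GHZ sector, `N ≥ 2` / `N ≥ 3`), `expect_collectiveSpin_ghzN_eq_zero` (`⟨J_x⟩ = ⟨J_y⟩ = 0`),
`expect_collectiveSpin_sq_ghzN` (`⟨J_x²⟩ = ⟨J_y²⟩ = N/4`), `variance_ghzN_collectiveSpin_XY`,
**`qfi_ghzN_collectiveSpin_XY`** (`F_Q[GHZ_N, J_x] = F_Q[GHZ_N, J_y] = N`, `N ≥ 3`) and **`sum_qfi_ghzN`**
(`Σ_l F_Q[GHZ_N, J_l] = N(N+2)`, with `QFICriterion.qfi_ghzN_eq_sq`).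

NOT formalized: saturation of Observation 2 by the symmetric Dicke state, the `k`-producibility bounds
(Observations 3–4; Hyllus et al. 2012), the average-sensitivity reformulation `avg_n F_Q ≤ ⅔N` (an integral over
`S²`).
Tree search (FAIL-DUP, 2026-09-01): `rg -n "collectiveSpin .* \* collectiveSpin|casimir|N \* \(N \+ 2\)"
Literature/InformationTheory` → no commutation relation / Casimir bound for `collectiveSpin` in the tree; the
one-qubit table `σ_xσ_y = iσ_z, …` exists as `MagicSquareGame.pauli_mul_table` and the entrywise product of Pauli
strings as `GraphStateStabilizerWitness.pauliWord_mul_apply` — both re-derived here as private one-liners rather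
than importing the nonlocal-game / graph-state cones; (2b)–(2d) are `SpinSqueezing.singlet_criterion` and
`OptimalSpinSqueezing.ineq_c` / `ineq_d`; `F_Q[ρ_sep, J_l] ≤ N` is `QFICriterion.qfi_le_of_isSeparable`.
-/

noncomputable section

open scoped BigOperators ComplexOrder ComplexConjugate
open Matrix Complex Finset
open Literature.Computability.QuantumComplexity
open Literature.InformationTheory.Entanglement.Tsirelson
open Literature.InformationTheory.StateDiscrimination

namespace Literature.InformationTheory.Entanglement

namespace QFISumBound

open SpinSqueezing GHZWitness MerminKlyshkoGHZ UnentangledSpins QFICriterion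

variable {N : ℕ}

/-! ## § 1 Pauli algebra on the register and the commutation relations `[J_a, J_b] = iJ_c` -/

/-- `σ_𝟙 = 𝟙`. [folklore] -/
private theorem pauliI_mat : (Pauli.I).mat = (1 : Matrix Bool Bool ℂ) := rfl

/-- Entries of a product of two Pauli strings (the Kronecker rule; cf.
`GraphStateStabilizerWitness.pauliWord_mul_apply`). [folklore] -/
private theorem pauliWord_mul_apply (u w : Fin N → Pauli) (x z : Fin N → Bool) :
    (pauliWord u * pauliWord w) x z = ∏ l, ((u l).mat * (w l).mat) (x l) (z l) := by
  rw [Matrix.mul_apply]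
  simp only [pauliWord_apply]
  have h : ∀ y : Fin N → Bool, (∏ j, (u j).mat (x j) (y j)) * (∏ j, (w j).mat (y j) (z j)) =
      ∏ j, (u j).mat (x j) (y j) * (w j).mat (y j) (z j) :=
    fun y => (Finset.prod_mul_distrib).symm
  simp_rw [h]
  rw [← Fintype.piFinset_univ, ← Finset.prod_univ_sum (fun _ => (Finset.univ : Finset Bool))
    (fun j b => (u j).mat (x j) b * (w j).mat b (z j))]
  refine Finset.prod_congr rfl fun j _ => ?_
  rw [Matrix.mul_apply]

/-- `σ_xσ_y = iσ_z` (cf. `MagicSquareGame.pauli_mul_table`). [folklore] -/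
private theorem matX_mul_matY : Pauli.X.mat * Pauli.Y.mat = Complex.I • Pauli.Z.mat := by
  ext a b; cases a <;> cases b <;> simp [Pauli.mul_apply_bool]

/-- `σ_yσ_x = −iσ_z`. [folklore] -/
private theorem matY_mul_matX : Pauli.Y.mat * Pauli.X.mat = (-Complex.I) • Pauli.Z.mat := by
  ext a b; cases a <;> cases b <;> simp [Pauli.mul_apply_bool]

/-- `σ_yσ_z = iσ_x`. [folklore] -/
private theorem matY_mul_matZ : Pauli.Y.mat * Pauli.Z.mat = Complex.I • Pauli.X.mat := by
  ext a b; cases a <;> cases b <;> simp [Pauli.mul_apply_bool]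

/-- `σ_zσ_y = −iσ_x`. [folklore] -/
private theorem matZ_mul_matY : Pauli.Z.mat * Pauli.Y.mat = (-Complex.I) • Pauli.X.mat := by
  ext a b; cases a <;> cases b <;> simp [Pauli.mul_apply_bool]

/-- `σ_zσ_x = iσ_y`. [folklore] -/
private theorem matZ_mul_matX : Pauli.Z.mat * Pauli.X.mat = Complex.I • Pauli.Y.mat := by
  ext a b; cases a <;> cases b <;> simp [Pauli.mul_apply_bool]

/-- `σ_xσ_z = −iσ_y`. [folklore] -/
private theorem matX_mul_matZ : Pauli.X.mat * Pauli.Z.mat = (-Complex.I) • Pauli.Y.mat := by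
  ext a b; cases a <;> cases b <;> simp [Pauli.mul_apply_bool]

/-- **Local Paulis at distinct sites commute**: `σ_a^{(i)}σ_b^{(j)} = σ_b^{(j)}σ_a^{(i)}` for `i ≠ j` (the
single-qubit observables `j_l^{(n)} = ½σ_l^{(n)}` of different qubits). [cite: Toth2012MultipartiteMetrology, §2
(proof of Observation 1)] -/
theorem localPauli_mul_comm {i j : Fin N} (hij : i ≠ j) (a b : Pauli) :
    localPauli a i * localPauli b j = localPauli b j * localPauli a i := by
  ext x z
  rw [localPauli, localPauli, pauliWord_mul_apply, pauliWord_mul_apply]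
  refine Finset.prod_congr rfl fun l _ => ?_
  by_cases hli : l = i
  · subst hli
    simp only [Function.update_self, Function.update_of_ne hij, pauliI_mat, Matrix.mul_one, Matrix.one_mul]
  · by_cases hlj : l = j
    · subst hlj
      simp only [Function.update_self, Function.update_of_ne hli, pauliI_mat, Matrix.mul_one, Matrix.one_mul]
    · simp only [Function.update_of_ne hli, Function.update_of_ne hlj]

/-- **Same-site products**: if `σ_aσ_b = s·σ_c` then `σ_a^{(i)}σ_b^{(i)} = s·σ_c^{(i)}`. [cite:
Toth2012MultipartiteMetrology, §2 («`J_l = ½Σ_k σ_l^{(k)}` where `σ_l^{(k)}` are the Pauli spin matrices for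
qubit `(k)`»)] -/
theorem localPauli_mul_same (i : Fin N) {a b c : Pauli} {s : ℂ} (h : a.mat * b.mat = s • c.mat) :
    localPauli a i * localPauli b i = s • localPauli c i := by
  ext x z
  rw [localPauli, localPauli, localPauli, pauliWord_mul_apply, Matrix.smul_apply, pauliWord_apply, smul_eq_mul,
    ← Finset.mul_prod_erase _ _ (Finset.mem_univ i), ← Finset.mul_prod_erase _ _ (Finset.mem_univ i)]
  simp only [Function.update_self]
  rw [h, Matrix.smul_apply, smul_eq_mul, mul_assoc]
  congr 2
  refine Finset.prod_congr rfl fun l hl => ?_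
  have hli : l ≠ i := Finset.ne_of_mem_erase hl
  simp only [Function.update_of_ne hli, pauliI_mat, Matrix.mul_one]

/-- `(σ_a^{(i)})² = 𝟙`. [folklore] -/
private theorem localPauli_mul_self (a : Pauli) (i : Fin N) : localPauli a i * localPauli a i = 1 :=
  pauliWord_mul_self _

/-- **The angular-momentum commutation relations on the register**: if `σ_aσ_b = iσ_c` and `σ_bσ_a = −iσ_c`
then `J_aJ_b − J_bJ_a = iJ_c` (`J_l = ½Σ_k σ_l^{(k)}`; the cross terms `k ≠ k'` commute). [cite:
Toth2012MultipartiteMetrology, §2 («the three angular momentum components»)] [cite: PezzeSmerzi2009, p. 2 («the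
“fictitious” angular momentum operator `Ĵ = Σ_l σ̂^{(l)}`»)] -/
theorem commutator_collectiveSpin {a b c : Pauli} (hab : a.mat * b.mat = Complex.I • c.mat)
    (hba : b.mat * a.mat = (-Complex.I) • c.mat) (N : ℕ) :
    collectiveSpin a N * collectiveSpin b N - collectiveSpin b N * collectiveSpin a N =
      Complex.I • collectiveSpin c N := by
  rw [collectiveSpin_eq_smul_sum a N, collectiveSpin_eq_smul_sum b N, collectiveSpin_eq_smul_sum c N,
    Matrix.smul_mul, Matrix.mul_smul, smul_smul, Matrix.smul_mul, Matrix.mul_smul, smul_smul, ← smul_sub,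
    smul_smul, Finset.sum_mul_sum, Finset.sum_mul_sum,
    Finset.sum_comm (f := fun i j => localPauli b i * localPauli a j), ← Finset.sum_sub_distrib]
  simp_rw [← Finset.sum_sub_distrib]
  have hdiag : ∀ y : Fin N, ∑ j, (localPauli a y * localPauli b j - localPauli b j * localPauli a y) =
      (2 * Complex.I) • localPauli c y := by
    intro y
    rw [Finset.sum_eq_single_of_mem y (Finset.mem_univ y) fun j _ hj => by
      rw [localPauli_mul_comm hj.symm, sub_self]]
    rw [localPauli_mul_same y hab, localPauli_mul_same y hba, ← sub_smul]
    congr 1; ring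
  simp_rw [hdiag]
  rw [← Finset.smul_sum, smul_smul]
  congr 1; ring

/-- `[J_x, J_y] = iJ_z`. [cite: Toth2012MultipartiteMetrology, §2] -/
theorem commutator_X_Y (N : ℕ) :
    collectiveSpin Pauli.X N * collectiveSpin Pauli.Y N - collectiveSpin Pauli.Y N * collectiveSpin Pauli.X N =
      Complex.I • collectiveSpin Pauli.Z N :=
  commutator_collectiveSpin matX_mul_matY matY_mul_matX N

/-- `[J_y, J_z] = iJ_x`. [cite: Toth2012MultipartiteMetrology, §2] -/
theorem commutator_Y_Z (N : ℕ) :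
    collectiveSpin Pauli.Y N * collectiveSpin Pauli.Z N - collectiveSpin Pauli.Z N * collectiveSpin Pauli.Y N =
      Complex.I • collectiveSpin Pauli.X N :=
  commutator_collectiveSpin matY_mul_matZ matZ_mul_matY N

/-- `[J_z, J_x] = iJ_y`. [cite: Toth2012MultipartiteMetrology, §2] -/
theorem commutator_Z_X (N : ℕ) :
    collectiveSpin Pauli.Z N * collectiveSpin Pauli.X N - collectiveSpin Pauli.X N * collectiveSpin Pauli.Z N =
      Complex.I • collectiveSpin Pauli.Y N :=
  commutator_collectiveSpin matZ_mul_matX matX_mul_matZ N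

/-! ## § 2 Pezzè–Smerzi's `χ² ≤ ξ²` on the register -/

/-- **`⟨J_c⟩² ≤ F_Q[ρ, J_a]·(ΔJ_b)²`** for every state of the register, every Hermitian SLD `T` of `ρ` along
`J_a`, and every triple with `σ_aσ_b = iσ_c = −σ_bσ_a` (so `[J_a, J_b] = iJ_c`): the register instance of
`QFIVariance.sq_expect_le_qfi_mul_variance_of_commutator` («By choosing `M̂ = Ĵ_{n₃} − ⟨Ĵ_{n₃}⟩` … we obtain that
`F_Q[ρ̂_inp, Ĵ_n] ≥ (dM₁/dθ)²/M₂`»). [cite: PezzeSmerzi2009, p. 3] [cite: TothApellaniz2014, §5.2 eq. (xichi)] -/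
theorem sq_expect_le_qfi_mul_varianceT {a b c : Pauli} (hab : a.mat * b.mat = Complex.I • c.mat)
    (hba : b.mat * a.mat = (-Complex.I) • c.mat) {ρ T : Matrix (Fin N → Bool) (Fin N → Bool) ℂ}
    (hρ : ρ.PosSemidef) (hρ1 : ρ.trace = 1) (hT : T.IsHermitian)
    (hTρ : T * ρ + ρ * T = Complex.I • (ρ * collectiveSpin a N - collectiveSpin a N * ρ)) :
    trState ρ (collectiveSpin c N) ^ 2 ≤
      (2 * (T * (Complex.I • (ρ * collectiveSpin a N - collectiveSpin a N * ρ))).trace).re *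
        varianceT ρ (collectiveSpin b N) := by
  rw [varianceT, trState_apply, trState_apply, trState_apply]
  exact QFIVariance.sq_expect_le_qfi_mul_variance_of_commutator hρ hρ1 (collectiveSpin_isHermitian c N)
    (collectiveSpin_isHermitian b N) hT (commutator_collectiveSpin hab hba N) hTρ

/-- **`χ² ≤ ξ²` (Pezzè–Smerzi)**: with `ξ² = N(ΔJ_{n₃})²/(⟨J_{n₁}⟩² + ⟨J_{n₂}⟩²)` and `χ² = N/F_Q[ρ, J_{n₂}]`, for
the register axes `(n₁, n₂, n₃) = (c, a, b)` with `σ_aσ_b = iσ_c = −σ_bσ_a`, in the printed normalisation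
`⟨J_{n₂}⟩ = 0` («without loss of generality») and with `⟨J_{n₁}⟩ ≠ 0` (so that `ξ²` is a quotient and
`F_Q > 0`): `N/F_Q[ρ, J_a] ≤ N(ΔJ_b)²/(⟨J_c⟩² + ⟨J_a⟩²)`. [cite: PezzeSmerzi2009, p. 2–3 («`χ ≤ ξ` for any
arbitrary `ρ̂_inp`»)] [cite: TothApellaniz2014, §5.2 eq. (xichi)] -/
theorem chi_sq_le_xi_sq {a b c : Pauli} (hab : a.mat * b.mat = Complex.I • c.mat)
    (hba : b.mat * a.mat = (-Complex.I) • c.mat) {ρ T : Matrix (Fin N → Bool) (Fin N → Bool) ℂ}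
    (hρ : ρ.PosSemidef) (hρ1 : ρ.trace = 1) (hT : T.IsHermitian)
    (hTρ : T * ρ + ρ * T = Complex.I • (ρ * collectiveSpin a N - collectiveSpin a N * ρ))
    (h0 : trState ρ (collectiveSpin a N) = 0) (hc : trState ρ (collectiveSpin c N) ≠ 0) :
    (N : ℝ) / (2 * (T * (Complex.I • (ρ * collectiveSpin a N - collectiveSpin a N * ρ))).trace).re ≤
      (N : ℝ) * varianceT ρ (collectiveSpin b N) /
        (trState ρ (collectiveSpin c N) ^ 2 + trState ρ (collectiveSpin a N) ^ 2) := by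
  have h := sq_expect_le_qfi_mul_varianceT hab hba hρ hρ1 hT hTρ
  have hx : 0 < trState ρ (collectiveSpin c N) ^ 2 := by positivity
  have hF0 := QFIVariance.qfi_nonneg hρ hT hTρ
  have hF : 0 < (2 * (T * (Complex.I • (ρ * collectiveSpin a N - collectiveSpin a N * ρ))).trace).re :=
    lt_of_le_of_ne hF0 fun h0' => by rw [← h0', zero_mul] at h; exact absurd h (not_le.mpr hx)
  have hV : 0 < varianceT ρ (collectiveSpin b N) :=
    lt_of_mul_lt_mul_left (by rw [mul_zero]; exact lt_of_lt_of_le hx h) hF.le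
  rw [h0, zero_pow two_ne_zero, add_zero, div_le_div_iff₀ hF hx]
  nlinarith [mul_le_mul_of_nonneg_left h (Nat.cast_nonneg (α := ℝ) N), hV]

/-! ## § 3 Tóth's Observation 1: `Σ_l F_Q[ρ, J_l] ≤ 2N` on fully separable states -/

/-- **Pure product states, the printed first step**: for unit factors `φ_i` and Hermitian SLDs `S_x, S_y, S_z` of
`P = |⊗φ⟩⟨⊗φ|` along `J_x, J_y, J_z`: `Σ_l F_Q[⊗φ, J_l] = 4Σ_l (ΔJ_l)² = 2N` («`F[ϱ,J_l] = 4(ΔJ_l)²_ϱ`» for pure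
states and «`Σ_l (ΔJ_l)²_{|Ψ_P⟩} = … = N/2`», `SpinSqueezing.sum_variance_productVec`). [cite:
Toth2012MultipartiteMetrology, §2 (proof of Observation 1)] -/
theorem sum_qfi_productVec_eq {φ : Fin N → Bool → ℂ} (hφ : ∀ i, star (φ i) ⬝ᵥ φ i = 1)
    {Sx Sy Sz : Matrix (Fin N → Bool) (Fin N → Bool) ℂ} (hSx : Sx.IsHermitian) (hSy : Sy.IsHermitian)
    (hSz : Sz.IsHermitian)
    (hx : Sx * vecMulVec (productVec φ) (star (productVec φ)) + vecMulVec (productVec φ) (star (productVec φ)) * Sx =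
      Complex.I • (vecMulVec (productVec φ) (star (productVec φ)) * collectiveSpin Pauli.X N -
        collectiveSpin Pauli.X N * vecMulVec (productVec φ) (star (productVec φ))))
    (hy : Sy * vecMulVec (productVec φ) (star (productVec φ)) + vecMulVec (productVec φ) (star (productVec φ)) * Sy =
      Complex.I • (vecMulVec (productVec φ) (star (productVec φ)) * collectiveSpin Pauli.Y N -
        collectiveSpin Pauli.Y N * vecMulVec (productVec φ) (star (productVec φ))))
    (hz : Sz * vecMulVec (productVec φ) (star (productVec φ)) + vecMulVec (productVec φ) (star (productVec φ)) * Sz =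
      Complex.I • (vecMulVec (productVec φ) (star (productVec φ)) * collectiveSpin Pauli.Z N -
        collectiveSpin Pauli.Z N * vecMulVec (productVec φ) (star (productVec φ)))) :
    (2 * (Sx * (Complex.I • (vecMulVec (productVec φ) (star (productVec φ)) * collectiveSpin Pauli.X N -
        collectiveSpin Pauli.X N * vecMulVec (productVec φ) (star (productVec φ))))).trace).re +
      (2 * (Sy * (Complex.I • (vecMulVec (productVec φ) (star (productVec φ)) * collectiveSpin Pauli.Y N -
        collectiveSpin Pauli.Y N * vecMulVec (productVec φ) (star (productVec φ))))).trace).re +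
      (2 * (Sz * (Complex.I • (vecMulVec (productVec φ) (star (productVec φ)) * collectiveSpin Pauli.Z N -
        collectiveSpin Pauli.Z N * vecMulVec (productVec φ) (star (productVec φ))))).trace).re = 2 * N := by
  have hψ := productVec_norm hφ
  rw [qfi_pure_eq_four_variance (collectiveSpin_isHermitian Pauli.X N) hSx hψ hx,
    qfi_pure_eq_four_variance (collectiveSpin_isHermitian Pauli.Y N) hSy hψ hy,
    qfi_pure_eq_four_variance (collectiveSpin_isHermitian Pauli.Z N) hSz hψ hz]
  have h := sum_variance_productVec φ hφ
  simp only [variance, vecState_apply] at h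
  linear_combination (4 : ℝ) * h

/-- **The convexity step, per direction**: for a mixture `ρ = Σ_k p_k |⊗φ_k⟩⟨⊗φ_k|` of pure product states
(`p_k ≥ 0`, unit factors) and every Hermitian SLD `T` of `ρ` along `J_l`,
`F_Q[ρ, J_l] ≤ Σ_k p_k F_Q[⊗φ_k, J_l] = Σ_k p_k Σ_i (1 − l_{k,i}²)` («`F[ϱ,J_l]` is convex in the state»;
`QuantumFisherInformationConvexity.qfi_convex` with the pure SLDs `Ŝ_k = ρ̇_k`, and `QFICriterion.qfi_productVec_eq`).
[cite: Toth2012MultipartiteMetrology, §2 (proof of Observation 1)] [cite: PezzeSmerzi2009, p. 3] -/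
theorem qfi_le_sum_bloch (l : Pauli) {ι : Type*} [Fintype ι] {p : ι → ℝ} (hp : ∀ k, 0 ≤ p k)
    {φ : ι → Fin N → Bool → ℂ} (hφ : ∀ k i, star (φ k i) ⬝ᵥ φ k i = 1)
    {ρ T : Matrix (Fin N → Bool) (Fin N → Bool) ℂ}
    (hρ : ρ = ∑ k, (p k : ℂ) • vecMulVec (productVec (φ k)) (star (productVec (φ k)))) (hT : T.IsHermitian)
    (hTρ : T * ρ + ρ * T = Complex.I • (ρ * collectiveSpin l N - collectiveSpin l N * ρ)) :
    (2 * (T * (Complex.I • (ρ * collectiveSpin l N - collectiveSpin l N * ρ))).trace).re ≤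
      ∑ k, p k * ∑ i, (1 - bloch l (φ k i) ^ 2) := by
  subst hρ
  have hJh : (collectiveSpin l N).IsHermitian := collectiveSpin_isHermitian l N
  -- the pure components `P_k = |⊗φ_k⟩⟨⊗φ_k|` and their SLDs `S_k = ρ̇_k`
  obtain ⟨P, hP⟩ : ∃ P : ι → Matrix (Fin N → Bool) (Fin N → Bool) ℂ,
      P = fun k => vecMulVec (productVec (φ k)) (star (productVec (φ k))) := ⟨_, rfl⟩
  obtain ⟨S, hS⟩ : ∃ S : ι → Matrix (Fin N → Bool) (Fin N → Bool) ℂ,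
      S = fun k => Complex.I • (P k * collectiveSpin l N - collectiveSpin l N * P k) := ⟨_, rfl⟩
  have hPk' : ∀ k, vecMulVec (productVec (φ k)) (star (productVec (φ k))) = P k := fun k => by rw [hP]
  simp_rw [hPk'] at hTρ ⊢
  have hψ1 : ∀ k, star (productVec (φ k)) ⬝ᵥ productVec (φ k) = 1 := fun k => productVec_norm (hφ k)
  have hPk : ∀ k, (P k).PosSemidef := fun k => by rw [hP]; exact posSemidef_vecMulVec_self_star _
  have hSk : ∀ k, (S k).IsHermitian := fun k => by
    rw [hS]; exact QFIVariance.unitaryDeriv_isHermitian (hPk k).1 hJh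
  have hSP : ∀ k, S k * P k + P k * S k = S k := fun k => by
    rw [hS, hP]; exact sld_vecMulVec hJh (hψ1 k)
  have hSk' : ∀ k, Complex.I • (P k * collectiveSpin l N - collectiveSpin l N * P k) = S k := fun k => by rw [hS]
  -- linearity: `Σ p_k ρ̇_k = ρ̇`
  have e : ∑ k, ((p k : ℝ) : ℂ) • (S k * P k + P k * S k) =
      Complex.I • ((∑ k, ((p k : ℝ) : ℂ) • P k) * collectiveSpin l N -
        collectiveSpin l N * ∑ k, ((p k : ℝ) : ℂ) • P k) := by
    simp_rw [hSP, ← hSk']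
    rw [Finset.sum_mul, Finset.mul_sum, ← Finset.sum_sub_distrib, Finset.smul_sum]
    refine sum_congr rfl fun k _ => ?_
    rw [smul_mul_assoc, mul_smul_comm, ← smul_sub, smul_comm]
  have hsld : T * (∑ k, ((p k : ℝ) : ℂ) • P k) + (∑ k, ((p k : ℝ) : ℂ) • P k) * T =
      ∑ k, ((p k : ℝ) : ℂ) • (S k * P k + P k * S k) := by rw [e]; exact hTρ
  have hconv := QFIConvexity.qfi_convex hp hPk hSk hT hsld
  rw [e] at hconv
  have htwo : ∀ z : ℂ, (2 * z).re = 2 * z.re := fun z => by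
    simp only [Complex.mul_re, Complex.re_ofNat, Complex.im_ofNat, zero_mul, sub_zero]
  -- each component: `2Tr(S_k ρ̇_k) = Σ_i (1 − l_{k,i}²)`
  have hcomp : ∀ k, 2 * (S k * (S k * P k + P k * S k)).trace.re = ∑ i, (1 - bloch l (φ k i) ^ 2) := by
    intro k
    have h := qfi_productVec_eq l (hφ k) (S := S k) (hSk k) (by rw [hPk', hSk']; exact hSP k)
    rw [hPk', hSk', htwo] at h
    rwa [hSP k]
  rw [htwo]
  calc 2 * (T * (Complex.I • ((∑ k, ((p k : ℝ) : ℂ) • P k) * collectiveSpin l N -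
          collectiveSpin l N * ∑ k, ((p k : ℝ) : ℂ) • P k))).trace.re
      ≤ ∑ k, p k * (2 * (S k * (S k * P k + P k * S k)).trace.re) := hconv
    _ = ∑ k, p k * ∑ i, (1 - bloch l (φ k i) ^ 2) := by simp_rw [hcomp]

/-- **Tóth's Observation 1 (F2ea)**: for every fully separable `N`-qubit state `ρ` and every triple of Hermitian
SLDs `T_x, T_y, T_z` of `ρ` along `J_x, J_y, J_z`: `F_Q[ρ, J_x] + F_Q[ρ, J_y] + F_Q[ρ, J_z] ≤ 2N`.  Proof as
printed: the pure-product value `2N` per component (`Σ_i Σ_l (1 − l_i²) = 2N` by `⟨σ_x⟩² + ⟨σ_y⟩² + ⟨σ_z⟩² = 1`)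
and convexity. [cite: Toth2012MultipartiteMetrology, Observation 1 eq. (F2ea)] -/
theorem sum_qfi_le_two_mul_of_isSeparable {ρ : Matrix (Fin N → Bool) (Fin N → Bool) ℂ} (hρ : IsSeparable ρ)
    {Tx Ty Tz : Matrix (Fin N → Bool) (Fin N → Bool) ℂ} (hTx : Tx.IsHermitian) (hTy : Ty.IsHermitian)
    (hTz : Tz.IsHermitian)
    (hx : Tx * ρ + ρ * Tx = Complex.I • (ρ * collectiveSpin Pauli.X N - collectiveSpin Pauli.X N * ρ))
    (hy : Ty * ρ + ρ * Ty = Complex.I • (ρ * collectiveSpin Pauli.Y N - collectiveSpin Pauli.Y N * ρ))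
    (hz : Tz * ρ + ρ * Tz = Complex.I • (ρ * collectiveSpin Pauli.Z N - collectiveSpin Pauli.Z N * ρ)) :
    (2 * (Tx * (Complex.I • (ρ * collectiveSpin Pauli.X N - collectiveSpin Pauli.X N * ρ))).trace).re +
      (2 * (Ty * (Complex.I • (ρ * collectiveSpin Pauli.Y N - collectiveSpin Pauli.Y N * ρ))).trace).re +
      (2 * (Tz * (Complex.I • (ρ * collectiveSpin Pauli.Z N - collectiveSpin Pauli.Z N * ρ))).trace).re ≤
      2 * N := by
  obtain ⟨ι, _, p, ψ, hp, h1, hψ, rfl⟩ := hρ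
  choose φ hφ hψφ using hψ
  have hρφ : ∑ k, (p k : ℂ) • vecMulVec (ψ k) (star (ψ k)) =
      ∑ k, (p k : ℂ) • vecMulVec (productVec (φ k)) (star (productVec (φ k))) :=
    sum_congr rfl fun k _ => by rw [hψφ k]
  have bx := qfi_le_sum_bloch Pauli.X hp hφ hρφ hTx hx
  have bY := qfi_le_sum_bloch Pauli.Y hp hφ hρφ hTy hy
  have bz := qfi_le_sum_bloch Pauli.Z hp hφ hρφ hTz hz
  have hsum : ∑ k, p k * ∑ i, (1 - bloch Pauli.X (φ k i) ^ 2) + ∑ k, p k * ∑ i, (1 - bloch Pauli.Y (φ k i) ^ 2) +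
      ∑ k, p k * ∑ i, (1 - bloch Pauli.Z (φ k i) ^ 2) = 2 * N := by
    rw [← sum_add_distrib, ← sum_add_distrib]
    have hk : ∀ k, p k * ∑ i, (1 - bloch Pauli.X (φ k i) ^ 2) + p k * ∑ i, (1 - bloch Pauli.Y (φ k i) ^ 2) +
        p k * ∑ i, (1 - bloch Pauli.Z (φ k i) ^ 2) = p k * (2 * N) := by
      intro k
      rw [← mul_add, ← mul_add, ← sum_add_distrib, ← sum_add_distrib]
      congr 1
      have hi : ∀ i, (1 - bloch Pauli.X (φ k i) ^ 2) + (1 - bloch Pauli.Y (φ k i) ^ 2) +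
          (1 - bloch Pauli.Z (φ k i) ^ 2) = 2 := fun i => by
        have := bloch_sq_sum (φ k i) (hφ k i); linarith
      simp_rw [hi]
      rw [sum_const, card_univ, Fintype.card_fin, nsmul_eq_mul, mul_comm]
    simp_rw [hk]
    rw [← sum_mul, h1, one_mul]
  linarith

/-- **«All states violating Eq. (F2ea) are entangled»**: a triple of Hermitian SLDs with
`F_Q[ρ, J_x] + F_Q[ρ, J_y] + F_Q[ρ, J_z] > 2N` certifies that `ρ` is not fully separable. [cite:
Toth2012MultipartiteMetrology, Observation 1] -/
theorem not_isSeparable_of_sum_qfi_gt {ρ Tx Ty Tz : Matrix (Fin N → Bool) (Fin N → Bool) ℂ}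
    (hTx : Tx.IsHermitian) (hTy : Ty.IsHermitian) (hTz : Tz.IsHermitian)
    (hx : Tx * ρ + ρ * Tx = Complex.I • (ρ * collectiveSpin Pauli.X N - collectiveSpin Pauli.X N * ρ))
    (hy : Ty * ρ + ρ * Ty = Complex.I • (ρ * collectiveSpin Pauli.Y N - collectiveSpin Pauli.Y N * ρ))
    (hz : Tz * ρ + ρ * Tz = Complex.I • (ρ * collectiveSpin Pauli.Z N - collectiveSpin Pauli.Z N * ρ))
    (hgt : 2 * (N : ℝ) <
      (2 * (Tx * (Complex.I • (ρ * collectiveSpin Pauli.X N - collectiveSpin Pauli.X N * ρ))).trace).re +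
      (2 * (Ty * (Complex.I • (ρ * collectiveSpin Pauli.Y N - collectiveSpin Pauli.Y N * ρ))).trace).re +
      (2 * (Tz * (Complex.I • (ρ * collectiveSpin Pauli.Z N - collectiveSpin Pauli.Z N * ρ))).trace).re) :
    ¬ IsSeparable ρ :=
  fun hρ => absurd (sum_qfi_le_two_mul_of_isSeparable hρ hTx hTy hTz hx hy hz) (not_le.mpr hgt)

/-! ## § 4 The Casimir bound `J_x² + J_y² + J_z² ≤ N(N+2)/4` and Observation 2 (all states) -/

/-- Regrouping a product of two two-site terms (`i ≠ j`): `(σ_a^{(i)}σ_b^{(j)})(σ_c^{(i)}σ_d^{(j)}) =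
(σ_a^{(i)}σ_c^{(i)})(σ_b^{(j)}σ_d^{(j)})`. [folklore] -/
private theorem two_site_mul {i j : Fin N} (hij : i ≠ j) (a b c d : Pauli) :
    localPauli a i * localPauli b j * (localPauli c i * localPauli d j) =
      localPauli a i * localPauli c i * (localPauli b j * localPauli d j) := by
  have h : localPauli b j * localPauli c i = localPauli c i * localPauli b j := (localPauli_mul_comm hij c b).symm
  rw [mul_assoc (localPauli a i) (localPauli b j), ← mul_assoc (localPauli b j) (localPauli c i), h,
    mul_assoc (localPauli a i) (localPauli c i), mul_assoc]

/-- **The exchange identity** for two distinct qubits `i ≠ j`: with `T_{ij} = Σ_{l=x,y,z} σ_l^{(i)}σ_l^{(j)}`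
(`= 2·SWAP_{ij} − 𝟙`), `T_{ij}² = 3·𝟙 − 2T_{ij}` (from `σ_aσ_b = iε_{abc}σ_c + δ_{ab}𝟙` at each site) — the
two-qubit content of «the theory of angular momentum». [cite: TothKnappGuhneBriegel2007, Appendix («Based on
the theory of angular momentum, Eq. (2a) is valid for all quantum states»)] -/
theorem exchange_sq {i j : Fin N} (hij : i ≠ j) :
    (localPauli Pauli.X i * localPauli Pauli.X j + localPauli Pauli.Y i * localPauli Pauli.Y j +
        localPauli Pauli.Z i * localPauli Pauli.Z j) *
      (localPauli Pauli.X i * localPauli Pauli.X j + localPauli Pauli.Y i * localPauli Pauli.Y j +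
        localPauli Pauli.Z i * localPauli Pauli.Z j) =
      (3 : ℂ) • (1 : Matrix (Fin N → Bool) (Fin N → Bool) ℂ) -
        (2 : ℂ) • (localPauli Pauli.X i * localPauli Pauli.X j + localPauli Pauli.Y i * localPauli Pauli.Y j +
          localPauli Pauli.Z i * localPauli Pauli.Z j) := by
  simp only [add_mul, mul_add, two_site_mul hij, localPauli_mul_self, localPauli_mul_same _ matX_mul_matY,
    localPauli_mul_same _ matY_mul_matX, localPauli_mul_same _ matY_mul_matZ, localPauli_mul_same _ matZ_mul_matY,
    localPauli_mul_same _ matZ_mul_matX, localPauli_mul_same _ matX_mul_matZ, Matrix.smul_mul, Matrix.mul_smul,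
    smul_smul, Matrix.one_mul, Complex.I_mul_I, neg_mul_neg, neg_one_smul]
  module

/-- `0 ≤ ¼` in the star order of `ℂ`. [folklore] -/
private theorem quarter_nonneg : (0 : ℂ) ≤ (1 / 4 : ℂ) := by
  rw [show (1 / 4 : ℂ) = ((1 / 4 : ℝ) : ℂ) by norm_num]
  exact Complex.zero_le_real.mpr (by norm_num)

/-- `T_{ij}` is Hermitian (`i ≠ j`: the two factors commute). [folklore] -/
private theorem exchange_isHermitian {i j : Fin N} (hij : i ≠ j) :
    (localPauli Pauli.X i * localPauli Pauli.X j + localPauli Pauli.Y i * localPauli Pauli.Y j +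
        localPauli Pauli.Z i * localPauli Pauli.Z j).IsHermitian := by
  have h : ∀ a : Pauli, (localPauli a i * localPauli a j).IsHermitian := fun a => by
    rw [Matrix.IsHermitian, conjTranspose_mul, (localPauli_isHermitian a i).eq, (localPauli_isHermitian a j).eq,
      ← localPauli_mul_comm hij a a]
  exact ((h Pauli.X).add (h Pauli.Y)).add (h Pauli.Z)

/-- **`T_{ij} ≤ 𝟙`** (`i ≠ j`): `𝟙 − T_{ij} = ¼(𝟙 − T_{ij})² ⪰ 0` by the exchange identity. [cite:
TothKnappGuhneBriegel2007, Appendix] -/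
theorem one_sub_exchange_posSemidef {i j : Fin N} (hij : i ≠ j) :
    ((1 : Matrix (Fin N → Bool) (Fin N → Bool) ℂ) -
      (localPauli Pauli.X i * localPauli Pauli.X j + localPauli Pauli.Y i * localPauli Pauli.Y j +
        localPauli Pauli.Z i * localPauli Pauli.Z j)).PosSemidef := by
  have hH := exchange_isHermitian hij
  have hsq := exchange_sq hij
  generalize (localPauli Pauli.X i * localPauli Pauli.X j + localPauli Pauli.Y i * localPauli Pauli.Y j +
        localPauli Pauli.Z i * localPauli Pauli.Z j) = T at hH hsq ⊢
  have key : (1 - T) = (1 / 4 : ℂ) • ((1 - T)ᴴ * (1 - T)) := by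
    rw [conjTranspose_sub, conjTranspose_one, hH.eq, sub_mul, mul_sub, mul_sub, one_mul, one_mul, mul_one, hsq]
    module
  rw [key]
  exact (posSemidef_conjTranspose_mul_self (1 - T)).smul quarter_nonneg

/-- `Σ_{k ∈ s} A_k ⪰ 0` for positive semidefinite summands. [folklore] -/
private theorem posSemidef_sum {ι m : Type*} [Fintype m] (s : Finset ι) {A : ι → Matrix m m ℂ}
    (h : ∀ k ∈ s, (A k).PosSemidef) : (∑ k ∈ s, A k).PosSemidef :=
  Finset.sum_induction A (fun M => M.PosSemidef) (fun _ _ ha hb => ha.add hb) PosSemidef.zero h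

/-- **`J_x² + J_y² + J_z² = ¼Σ_iΣ_j T_{ij}`** with `T_{ij} = Σ_l σ_l^{(i)}σ_l^{(j)}` (`T_{ii} = 3·𝟙`). [cite:
Toth2012MultipartiteMetrology, §2 (proof of Observation 2)] -/
theorem sum_collectiveSpin_sq_eq (N : ℕ) :
    collectiveSpin Pauli.X N * collectiveSpin Pauli.X N + collectiveSpin Pauli.Y N * collectiveSpin Pauli.Y N +
        collectiveSpin Pauli.Z N * collectiveSpin Pauli.Z N =
      (1 / 4 : ℂ) • ∑ i : Fin N, ∑ j : Fin N,
        (localPauli Pauli.X i * localPauli Pauli.X j + localPauli Pauli.Y i * localPauli Pauli.Y j +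
          localPauli Pauli.Z i * localPauli Pauli.Z j) := by
  have hsq : ∀ a : Pauli, collectiveSpin a N * collectiveSpin a N =
      (1 / 4 : ℂ) • ∑ i : Fin N, ∑ j : Fin N, localPauli a i * localPauli a j := by
    intro a
    rw [collectiveSpin_eq_smul_sum, Matrix.smul_mul, Matrix.mul_smul, smul_smul, Finset.sum_mul_sum]
    norm_num
  rw [hsq, hsq, hsq, ← smul_add, ← smul_add]
  congr 1
  simp only [← Finset.sum_add_distrib]

/-- **The Casimir bound («a fundamental equation in the theory of angular momentum»)**: on the `N`-qubit
register `J_x² + J_y² + J_z² ≤ N(N+2)/4 · 𝟙 = j(j+1)𝟙|_{j=N/2}`, as the Loewner-order statement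
`N(N+2)/4·𝟙 − (J_x² + J_y² + J_z²) = ¼Σ_{i≠j}(𝟙 − T_{ij}) ⪰ 0`. [cite: Toth2012MultipartiteMetrology, §2 eq.
(ineq-1)] [cite: TothKnappGuhneBriegel2007, Observation 1 (2a) and Appendix] -/
theorem casimir_posSemidef (N : ℕ) :
    ((((N : ℝ) * (N + 2) / 4 : ℝ) : ℂ) • (1 : Matrix (Fin N → Bool) (Fin N → Bool) ℂ) -
      (collectiveSpin Pauli.X N * collectiveSpin Pauli.X N + collectiveSpin Pauli.Y N * collectiveSpin Pauli.Y N +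
        collectiveSpin Pauli.Z N * collectiveSpin Pauli.Z N)).PosSemidef := by
  rw [sum_collectiveSpin_sq_eq]
  -- abbreviate the two-site terms
  obtain ⟨T, hT⟩ : ∃ T : Fin N → Fin N → Matrix (Fin N → Bool) (Fin N → Bool) ℂ, T = fun i j =>
      localPauli Pauli.X i * localPauli Pauli.X j + localPauli Pauli.Y i * localPauli Pauli.Y j +
        localPauli Pauli.Z i * localPauli Pauli.Z j := ⟨_, rfl⟩
  have hT' : ∀ i j, localPauli Pauli.X i * localPauli Pauli.X j + localPauli Pauli.Y i * localPauli Pauli.Y j +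
      localPauli Pauli.Z i * localPauli Pauli.Z j = T i j := fun i j => by rw [hT]
  simp_rw [hT']
  have hdiag : ∀ i : Fin N, T i i = (3 : ℂ) • 1 := fun i => by
    rw [← hT', localPauli_mul_self, localPauli_mul_self, localPauli_mul_self]; module
  have hoff : ∀ i j : Fin N, i ≠ j → (1 - T i j).PosSemidef := fun i j hij => by
    rw [← hT']; exact one_sub_exchange_posSemidef hij
  -- the PSD decomposition `¼ Σ_i Σ_j S_{ij}`, `S_{ij} = 𝟙 − T_{ij}` off the diagonal and `0` on it
  have key : (((N : ℝ) * (N + 2) / 4 : ℝ) : ℂ) • (1 : Matrix (Fin N → Bool) (Fin N → Bool) ℂ) -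
      (1 / 4 : ℂ) • ∑ i : Fin N, ∑ j : Fin N, T i j =
      (1 / 4 : ℂ) • ∑ i : Fin N, ∑ j : Fin N, (if i = j then (0 : Matrix (Fin N → Bool) (Fin N → Bool) ℂ)
        else 1 - T i j) := by
    have hS : ∀ i j : Fin N, (if i = j then (0 : Matrix (Fin N → Bool) (Fin N → Bool) ℂ) else 1 - T i j) =
        (1 - T i j) + (if i = j then (2 : ℂ) • (1 : Matrix (Fin N → Bool) (Fin N → Bool) ℂ) else 0) := by
      intro i j
      by_cases h : i = j
      · subst h; rw [if_pos rfl, if_pos rfl, hdiag]; module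
      · rw [if_neg h, if_neg h, add_zero]
    simp_rw [hS]
    simp only [Finset.sum_add_distrib, Finset.sum_sub_distrib, Finset.sum_ite_eq, Finset.mem_univ, if_true,
      Finset.sum_const, Finset.card_univ, Fintype.card_fin, ← Nat.cast_smul_eq_nsmul ℂ, smul_smul]
    push_cast
    module
  rw [key]
  refine PosSemidef.smul (posSemidef_sum _ fun i _ => posSemidef_sum _ fun j _ => ?_) quarter_nonneg
  by_cases h : i = j
  · rw [if_pos h]; exact PosSemidef.zero
  · rw [if_neg h]; exact hoff i j h

/-- **TKGB (2a) / Tóth (ineq-1): `⟨J_x²⟩ + ⟨J_y²⟩ + ⟨J_z²⟩ ≤ N(N+2)/4` for ALL states** (`ρ ⪰ 0`, `Tr ρ = 1`).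
[cite: TothKnappGuhneBriegel2007, Observation 1 (2a)] [cite: Toth2012MultipartiteMetrology, §2 eq. (ineq-1)] -/
theorem sum_expect_sq_le {ρ : Matrix (Fin N → Bool) (Fin N → Bool) ℂ} (hρ : ρ.PosSemidef) (hρ1 : ρ.trace = 1) :
    trState ρ (collectiveSpin Pauli.X N * collectiveSpin Pauli.X N) +
        trState ρ (collectiveSpin Pauli.Y N * collectiveSpin Pauli.Y N) +
        trState ρ (collectiveSpin Pauli.Z N * collectiveSpin Pauli.Z N) ≤ (N : ℝ) * (N + 2) / 4 := by
  have h := Literature.LinearAlgebra.Matrix.re_trace_mul_nonneg_of_posSemidef hρ (casimir_posSemidef N)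
  rw [Matrix.mul_sub, Matrix.mul_smul, Matrix.mul_one, trace_sub, trace_smul, hρ1, Complex.sub_re, smul_eq_mul,
    mul_one, Complex.ofReal_re, ← trState_apply, map_add, map_add] at h
  linarith

/-- **`Σ_l (ΔJ_l)² ≤ Σ_l ⟨J_l²⟩ ≤ N(N+2)/4`** for all states. [cite: Toth2012MultipartiteMetrology, §2 eq. (ineq-1)] -/
theorem sum_varianceT_le {ρ : Matrix (Fin N → Bool) (Fin N → Bool) ℂ} (hρ : ρ.PosSemidef) (hρ1 : ρ.trace = 1) :
    varianceT ρ (collectiveSpin Pauli.X N) + varianceT ρ (collectiveSpin Pauli.Y N) +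
        varianceT ρ (collectiveSpin Pauli.Z N) ≤ (N : ℝ) * (N + 2) / 4 := by
  have h := sum_expect_sq_le hρ hρ1
  simp only [varianceT]
  nlinarith [sq_nonneg (trState ρ (collectiveSpin Pauli.X N)), sq_nonneg (trState ρ (collectiveSpin Pauli.Y N)),
    sq_nonneg (trState ρ (collectiveSpin Pauli.Z N))]

/-- **Tóth's Observation 2 (eq:all)**: for EVERY state of the register and every triple of Hermitian SLDs along
`J_x, J_y, J_z`: `F_Q[ρ, J_x] + F_Q[ρ, J_y] + F_Q[ρ, J_z] ≤ N(N+2)` («the quantum Fisher is never larger than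
the corresponding variance … and … `4Σ_l ⟨J_l²⟩ ≤ N(N+2)`»). [cite: Toth2012MultipartiteMetrology, Observation 2
eq. (all)] -/
theorem sum_qfi_le {ρ Tx Ty Tz : Matrix (Fin N → Bool) (Fin N → Bool) ℂ} (hρ : ρ.PosSemidef)
    (hρ1 : ρ.trace = 1) (hTx : Tx.IsHermitian) (hTy : Ty.IsHermitian) (hTz : Tz.IsHermitian)
    (hx : Tx * ρ + ρ * Tx = Complex.I • (ρ * collectiveSpin Pauli.X N - collectiveSpin Pauli.X N * ρ))
    (hy : Ty * ρ + ρ * Ty = Complex.I • (ρ * collectiveSpin Pauli.Y N - collectiveSpin Pauli.Y N * ρ))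
    (hz : Tz * ρ + ρ * Tz = Complex.I • (ρ * collectiveSpin Pauli.Z N - collectiveSpin Pauli.Z N * ρ)) :
    (2 * (Tx * (Complex.I • (ρ * collectiveSpin Pauli.X N - collectiveSpin Pauli.X N * ρ))).trace).re +
      (2 * (Ty * (Complex.I • (ρ * collectiveSpin Pauli.Y N - collectiveSpin Pauli.Y N * ρ))).trace).re +
      (2 * (Tz * (Complex.I • (ρ * collectiveSpin Pauli.Z N - collectiveSpin Pauli.Z N * ρ))).trace).re ≤
      (N : ℝ) * (N + 2) := by
  have bx := QFIVariance.qfi_le_four_variance hρ hρ1 (collectiveSpin_isHermitian Pauli.X N) hTx hx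
  have bY := QFIVariance.qfi_le_four_variance hρ hρ1 (collectiveSpin_isHermitian Pauli.Y N) hTy hy
  have bz := QFIVariance.qfi_le_four_variance hρ hρ1 (collectiveSpin_isHermitian Pauli.Z N) hTz hz
  have h := sum_varianceT_le hρ hρ1
  simp only [varianceT, trState_apply] at h
  linarith

/-! ## § 5 Saturation of Observation 2 by the GHZ state: `F_Q[GHZ_N, J_x] = F_Q[GHZ_N, J_y] = N`, `Σ_l = N(N+2)` -/

/-- Matrix elements of a Pauli string between the constant kets: `⟨b…b|⊗σ_u|b'…b'⟩ = Π_l (σ_{u_l})_{bb'}`.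
[folklore] -/
private theorem pauliWord_apply_const (u : Fin N → Pauli) (b b' : Bool) :
    pauliWord u (constLabel N b) (constLabel N b') = ∏ l, (u l).mat b b' := by
  rw [pauliWord_apply]; rfl

/-- `⟨b…b|σ_l^{(i)}|b'…b'⟩ = 0` for `l ∈ {x, y}` and `N ≥ 2` (a single bit flip leaves the GHZ sector).
[cite: Toth2012MultipartiteMetrology, §2 (after Observation 2: «Greenberger-Horne-Zeilinger states … saturate
Eq. (all)»)] -/
theorem localPauli_apply_const_eq_zero (h2 : 2 ≤ N) {l : Pauli} (hl : l = Pauli.X ∨ l = Pauli.Y) (i : Fin N)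
    (b b' : Bool) : localPauli l i (constLabel N b) (constLabel N b') = 0 := by
  rw [localPauli, pauliWord_apply_const]
  by_cases hb : b = b'
  · subst hb
    refine Finset.prod_eq_zero (Finset.mem_univ i) ?_
    rw [Function.update_self]
    rcases hl with rfl | rfl <;> cases b <;> simp
  · have : Nontrivial (Fin N) := Fin.nontrivial_iff_two_le.mpr h2
    obtain ⟨k, hk⟩ := exists_ne i
    refine Finset.prod_eq_zero (Finset.mem_univ k) ?_
    rw [Function.update_of_ne hk, Pauli.mat_I_apply, if_neg hb]

/-- `⟨b…b|σ_l^{(i)}σ_l^{(j)}|b'…b'⟩ = 0` for `l ∈ {x, y}`, `i ≠ j` and `N ≥ 3` (two bit flips leave the GHZ sector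
when a third qubit exists). [cite: Toth2012MultipartiteMetrology, §2 (after Observation 2)] -/
theorem localPauli_mul_apply_const_eq_zero (h3 : 3 ≤ N) {l : Pauli} (hl : l = Pauli.X ∨ l = Pauli.Y) {i j : Fin N}
    (hij : i ≠ j) (b b' : Bool) : (localPauli l i * localPauli l j) (constLabel N b) (constLabel N b') = 0 := by
  rw [localPauli, localPauli, pauliWord_mul_apply]
  simp only [constLabel_apply]
  by_cases hb : b = b'
  · subst hb
    refine Finset.prod_eq_zero (Finset.mem_univ i) ?_
    rw [Function.update_self, Function.update_of_ne hij, pauliI_mat, Matrix.mul_one]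
    rcases hl with rfl | rfl <;> cases b <;> simp
  · -- a third index `k ∉ {i, j}`
    have hcard : 0 < ((Finset.univ.erase i).erase j).card := by
      rw [Finset.card_erase_of_mem (Finset.mem_erase.mpr ⟨hij.symm, Finset.mem_univ j⟩),
        Finset.card_erase_of_mem (Finset.mem_univ i), Finset.card_univ, Fintype.card_fin]
      omega
    obtain ⟨k, hk⟩ := Finset.card_pos.mp hcard
    simp only [Finset.mem_erase, Finset.mem_univ, and_true] at hk
    refine Finset.prod_eq_zero (Finset.mem_univ k) ?_
    rw [Function.update_of_ne hk.2, Function.update_of_ne hk.1, pauliI_mat, Matrix.mul_one, Matrix.one_apply_ne hb]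

/-- `⟨GHZ_N|M|GHZ_N⟩ = 0` when all four matrix elements of `M` between `|0…0⟩`, `|1…1⟩` vanish. [folklore] -/
private theorem ghzN_expect_eq_zero {M : Matrix (Fin N → Bool) (Fin N → Bool) ℂ}
    (h : ∀ b b' : Bool, M (constLabel N b) (constLabel N b') = 0) : star (ghzN N) ⬝ᵥ (M *ᵥ ghzN N) = 0 := by
  have hM : ∀ x, (M *ᵥ ghzN N) x =
      (CHSHOpt.invSqrtTwo : ℂ) * (M x (constLabel N false) + M x (constLabel N true)) := by
    intro x
    rw [ghzN, mulVec_smul, mulVec_add, Pi.smul_apply, Pi.add_apply, smul_eq_mul, ket, ket, Matrix.mulVec_single_one,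
      Matrix.mulVec_single_one, Matrix.col_apply, Matrix.col_apply]
  rw [star_ghzN_dotProduct, hM, hM, h, h, h, h]
  ring

/-- **`⟨GHZ_N|J_l|GHZ_N⟩ = 0` for `l ∈ {x, y}`** (`N ≥ 2`). [cite: Toth2012MultipartiteMetrology, §2 (after Observation 2;
«pure symmetric states for which `⟨J_l⟩ = 0` for `l = x,y,z` saturate Eq. (all)»)] -/
theorem expect_collectiveSpin_ghzN_eq_zero (h2 : 2 ≤ N) {l : Pauli} (hl : l = Pauli.X ∨ l = Pauli.Y) :
    star (ghzN N) ⬝ᵥ (collectiveSpin l N *ᵥ ghzN N) = 0 := by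
  refine ghzN_expect_eq_zero fun b b' => ?_
  rw [collectiveSpin_eq_smul_sum, Matrix.smul_apply, Matrix.sum_apply,
    Finset.sum_eq_zero fun i _ => localPauli_apply_const_eq_zero h2 hl i b b', smul_zero]

/-- **`⟨GHZ_N|J_l²|GHZ_N⟩ = N/4` for `l ∈ {x, y}`** (`N ≥ 3`): only the diagonal terms `(σ_l^{(i)})² = 𝟙` of
`J_l² = ¼Σ_{i,j}σ_l^{(i)}σ_l^{(j)}` survive. [cite: Toth2012MultipartiteMetrology, §2 (after Observation 2)] -/
theorem expect_collectiveSpin_sq_ghzN (h3 : 3 ≤ N) {l : Pauli} (hl : l = Pauli.X ∨ l = Pauli.Y) :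
    star (ghzN N) ⬝ᵥ ((collectiveSpin l N * collectiveSpin l N) *ᵥ ghzN N) = (N : ℂ) / 4 := by
  have : NeZero N := ⟨by omega⟩
  -- `J_l² = ¼(N·𝟙 + Σ_{i≠j} σ^iσ^j)`; the off-diagonal part has vanishing GHZ matrix elements
  have hsq : collectiveSpin l N * collectiveSpin l N =
      (1 / 4 : ℂ) • (((N : ℂ)) • (1 : Matrix (Fin N → Bool) (Fin N → Bool) ℂ) +
        ∑ i : Fin N, ∑ j ∈ Finset.univ.erase i, localPauli l i * localPauli l j) := by
    rw [collectiveSpin_eq_smul_sum, Matrix.smul_mul, Matrix.mul_smul, smul_smul, Finset.sum_mul_sum]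
    have hdiag : ∀ i : Fin N, ∑ j, localPauli l i * localPauli l j =
        1 + ∑ j ∈ Finset.univ.erase i, localPauli l i * localPauli l j := by
      intro i
      rw [← Finset.add_sum_erase _ _ (Finset.mem_univ i), localPauli_mul_self]
    simp_rw [hdiag]
    rw [Finset.sum_add_distrib, Finset.sum_const, Finset.card_univ, Fintype.card_fin, ← Nat.cast_smul_eq_nsmul ℂ]
    norm_num
  have hoff : star (ghzN N) ⬝ᵥ ((∑ i : Fin N, ∑ j ∈ Finset.univ.erase i, localPauli l i * localPauli l j) *ᵥ ghzN N) = 0 := by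
    refine ghzN_expect_eq_zero fun b b' => ?_
    rw [Matrix.sum_apply]
    refine Finset.sum_eq_zero fun i _ => ?_
    rw [Matrix.sum_apply]
    exact Finset.sum_eq_zero fun j hj => localPauli_mul_apply_const_eq_zero h3 hl (Finset.ne_of_mem_erase hj).symm b b'
  rw [hsq, Matrix.smul_mulVec, dotProduct_smul, Matrix.add_mulVec, dotProduct_add, hoff, add_zero, Matrix.smul_mulVec,
    one_mulVec, dotProduct_smul, ghzN_norm, smul_eq_mul, smul_eq_mul, mul_one]
  ring

/-- **`(ΔJ_l)²_{GHZ_N} = N/4` for `l ∈ {x, y}`, `N ≥ 3`.** [cite: Toth2012MultipartiteMetrology, §2 (after Observation 2)] -/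
theorem variance_ghzN_collectiveSpin_XY (h3 : 3 ≤ N) {l : Pauli} (hl : l = Pauli.X ∨ l = Pauli.Y) :
    variance (ghzN N) (collectiveSpin l N) = (N : ℝ) / 4 := by
  rw [variance, vecState_apply, vecState_apply, expect_collectiveSpin_sq_ghzN h3 hl,
    expect_collectiveSpin_ghzN_eq_zero (by omega) hl, Complex.zero_re]
  rw [← Complex.ofReal_natCast, ← Complex.ofReal_ofNat, ← Complex.ofReal_div, Complex.ofReal_re]
  ring

/-- **`F_Q[GHZ_N, J_x] = F_Q[GHZ_N, J_y] = N`** (`N ≥ 3`), for every Hermitian SLD of `|GHZ_N⟩⟨GHZ_N|` along `J_l`,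
`l ∈ {x, y}` (pure state: `F_Q = 4(ΔJ_l)²`). [cite: Toth2012MultipartiteMetrology, §2 (after Observation 2)]
[cite: TothApellaniz2014, §5.2] -/
theorem qfi_ghzN_collectiveSpin_XY (h3 : 3 ≤ N) {l : Pauli} (hl : l = Pauli.X ∨ l = Pauli.Y)
    {S : Matrix (Fin N → Bool) (Fin N → Bool) ℂ} (hS : S.IsHermitian)
    (hSP : S * vecMulVec (ghzN N) (star (ghzN N)) + vecMulVec (ghzN N) (star (ghzN N)) * S =
      Complex.I • (vecMulVec (ghzN N) (star (ghzN N)) * collectiveSpin l N -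
        collectiveSpin l N * vecMulVec (ghzN N) (star (ghzN N)))) :
    (2 * (S * (Complex.I • (vecMulVec (ghzN N) (star (ghzN N)) * collectiveSpin l N -
        collectiveSpin l N * vecMulVec (ghzN N) (star (ghzN N))))).trace).re = N := by
  have : NeZero N := ⟨by omega⟩
  rw [qfi_pure_eq_four_variance (collectiveSpin_isHermitian l N) hS ghzN_norm hSP]
  have h := variance_ghzN_collectiveSpin_XY h3 hl
  rw [variance, vecState_apply, vecState_apply] at h
  rw [h]
  ring

/-- **The GHZ state saturates Observation 2**: for `N ≥ 3` and every triple of Hermitian SLDs of `|GHZ_N⟩⟨GHZ_N|`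
along `J_x, J_y, J_z`: `F_Q[GHZ_N, J_x] + F_Q[GHZ_N, J_y] + F_Q[GHZ_N, J_z] = N + N + N² = N(N+2)`
(«Greenberger-Horne-Zeilinger states … saturate Eq. (all)»; `F_Q[GHZ_N, J_z] = N²` is
`QFICriterion.qfi_ghzN_eq_sq`). [cite: Toth2012MultipartiteMetrology, Observation 2 (saturation)] -/
theorem sum_qfi_ghzN (h3 : 3 ≤ N) {Sx Sy Sz : Matrix (Fin N → Bool) (Fin N → Bool) ℂ} (hSx : Sx.IsHermitian)
    (hSy : Sy.IsHermitian) (hSz : Sz.IsHermitian)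
    (hx : Sx * vecMulVec (ghzN N) (star (ghzN N)) + vecMulVec (ghzN N) (star (ghzN N)) * Sx =
      Complex.I • (vecMulVec (ghzN N) (star (ghzN N)) * collectiveSpin Pauli.X N -
        collectiveSpin Pauli.X N * vecMulVec (ghzN N) (star (ghzN N))))
    (hy : Sy * vecMulVec (ghzN N) (star (ghzN N)) + vecMulVec (ghzN N) (star (ghzN N)) * Sy =
      Complex.I • (vecMulVec (ghzN N) (star (ghzN N)) * collectiveSpin Pauli.Y N -
        collectiveSpin Pauli.Y N * vecMulVec (ghzN N) (star (ghzN N))))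
    (hz : Sz * vecMulVec (ghzN N) (star (ghzN N)) + vecMulVec (ghzN N) (star (ghzN N)) * Sz =
      Complex.I • (vecMulVec (ghzN N) (star (ghzN N)) * collectiveSpin Pauli.Z N -
        collectiveSpin Pauli.Z N * vecMulVec (ghzN N) (star (ghzN N)))) :
    (2 * (Sx * (Complex.I • (vecMulVec (ghzN N) (star (ghzN N)) * collectiveSpin Pauli.X N -
        collectiveSpin Pauli.X N * vecMulVec (ghzN N) (star (ghzN N))))).trace).re +
      (2 * (Sy * (Complex.I • (vecMulVec (ghzN N) (star (ghzN N)) * collectiveSpin Pauli.Y N -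
        collectiveSpin Pauli.Y N * vecMulVec (ghzN N) (star (ghzN N))))).trace).re +
      (2 * (Sz * (Complex.I • (vecMulVec (ghzN N) (star (ghzN N)) * collectiveSpin Pauli.Z N -
        collectiveSpin Pauli.Z N * vecMulVec (ghzN N) (star (ghzN N))))).trace).re = (N : ℝ) * (N + 2) := by
  have : NeZero N := ⟨by omega⟩
  rw [qfi_ghzN_collectiveSpin_XY h3 (Or.inl rfl) hSx hx, qfi_ghzN_collectiveSpin_XY h3 (Or.inr rfl) hSy hy,
    qfi_ghzN_eq_sq hSz hz]
  ring

end QFISumBound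

end Literature.InformationTheory.Entanglement
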